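import Mathlib.RingTheory.MvPolynomial.Basic
import Mathlib.RingTheory.MvPolynomial.Ideal
import Mathlib.Algebra.MvPolynomial.CommRing
import Mathlib.RingTheory.Ideal.Maps
import Mathlib.RingTheory.Ideal.Quotient.Operations
import Mathlib.RingTheory.Nilpotent.Basic
import Mathlib.LinearAlgebra.Matrix.NonsingularInverse
import Mathlib.Algebra.CharP.Lemmas
import Mathlib.Algebra.CharP.Quotient
import HarnessLib

/-!
# Fedder's test under a unimodular monomial change of torus coordinates (toric chart theorem, core B3)
(crux `FInjectiveMacaulayfication`, hole #4 class CN / hole #3 strata; toward idea-2's `toricChart_fedder`)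

[OURS · L1 W4.5a] Support file for crux stmt-ResolutionOfSingularities-15315
(`Summit.ResolutionOfSingularities.ResolutionOfSingularities.Theses.FrobeniusLadder.FInjectiveMacaulayfication`, route
`FrobeniusLadder`, skeleton v11 `86e9127b5c98b8e6`).  Seat table v5 (stub-1 (b)), part B3 of the decomposition of idea-2's
`toricChart_fedder` (STATUS 2026-08-27): the monomial chart map `θ : K[X] → K[Y]`, `X_j ↦ ∏ᵢ Yᵢ ^ V i j`, of a UNIMODULAR exponent
matrix `V` is not invertible on polynomial rings, but it transports Fedder's non-membership test between TORUS points: for `ã` with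
all `ãᵢ ≠ 0` and `b_j = ∏ᵢ ãᵢ ^ V i j`,

  `θ(h)^r ∈ ((Yᵢ - ãᵢ)^p : i)  ⟹  h^r ∈ ((X_j - b_j)^p : j)`       (`pow_mem_frobeniusSpan_of_monomialChart`),

i.e. `FedderAt p h b → FedderAt p (θ h) ã` in idea-2's notation.  Proof: `θ` induces a `K`-algebra map of the Artinian «Frobenius
neighbourhoods» `θ̄ : K[X]/((X_j - b_j)^p) → K[Y]/((Yᵢ - ãᵢ)^p)` (a polynomial vanishing at `ã` lies in `(Yᵢ - ãᵢ)`, and in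
characteristic `p` the `p`-th power of an element of `(gᵢ)` lies in `(gᵢ^p)`), and `θ̄` is INJECTIVE because it has a left inverse
`ψ̄ : Yᵢ ↦ ∏_j x̄_j ^ M i j` with `M = (V⁻¹)ᵀ ∈ GL_n(ℤ)` — integer powers of the classes `x̄_j`, which are units modulo `((X_j - b_j)^p)`
(`b_j ≠ 0` plus a nilpotent).

* §0 helpers: `pow_char_mem_span_pow` (char `p`: `z ∈ (gᵢ) ⇒ z^p ∈ (gᵢ^p)`), `mem_span_X_sub_C_of_aeval_eq_zero`
  (`q(a) = 0 ⇒ q ∈ (Xᵢ - aᵢ)`, by translation to the origin and `MvPolynomial.mem_ideal_span_X_image`);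
* §1 `map_frobeniusSpan_le_of_monomialChart` — `θ` maps `((X_j - b_j)^p)` into `((Yᵢ - ãᵢ)^p)`;
* §2 `isUnit_mk_X` — `x̄_j` is a unit in `K[X]/((X_j - b_j)^p)`; the inverse chart `ψ̄` and `ψ̄ ∘ θ̄ = id`;
* §3 `pow_mem_frobeniusSpan_of_monomialChart` — the transport.

Folklore (étale-ness of unimodular monomial maps on tori, read through Frobenius neighbourhoods); no definition is declared; AI-written,
weaker than expert review; no statement of [claim: Hironaka2017] is used.
-/

-- single-problem summit: the doubled namespace component is forced
set_option linter.dupNamespace false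

noncomputable section

namespace Summit.ResolutionOfSingularities.ResolutionOfSingularities.Theorems.FInjectiveMacaulayfication.MonomialChartFrobeniusTransport

open MvPolynomial

/-! ## §0 Helpers -/

/-- In characteristic `p`: if `z ∈ (g₁, …, g_m)` then `z^p ∈ (g₁^p, …, g_m^p)`. [folklore] -/
theorem pow_char_mem_span_pow {R : Type*} [CommRing R] (p : ℕ) [Fact p.Prime] [CharP R p] {m : ℕ} (g : Fin m → R)
    {z : R} (hz : z ∈ Ideal.span (Set.range g)) : z ^ p ∈ Ideal.span (Set.range fun i => g i ^ p) := by
  obtain ⟨c, hc⟩ := Ideal.mem_span_range_iff_exists_fun.mp hz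
  rw [← hc, sum_pow_char]
  refine Ideal.sum_mem _ fun i _ => ?_
  rw [mul_pow]
  exact Ideal.mul_mem_left _ _ (Ideal.subset_span ⟨i, rfl⟩)

/-- **A polynomial vanishing at a `K`-point lies in the point's ideal**: `q(a) = 0 ⇒ q ∈ (Xᵢ - aᵢ : i)` (translate `a` to the origin,
where the ideal of the origin consists of the polynomials without constant term, `MvPolynomial.mem_ideal_span_X_image`). [folklore] -/
theorem mem_span_X_sub_C_of_aeval_eq_zero {K : Type*} [Field K] {n : ℕ} (a : Fin n → K) (q : MvPolynomial (Fin n) K)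
    (hq : aeval a q = 0) : q ∈ Ideal.span (Set.range fun i : Fin n => X i - C (a i)) := by
  -- translation `τ : Xᵢ ↦ Xᵢ + aᵢ` and its inverse `σ : Xᵢ ↦ Xᵢ - aᵢ`
  set τ : MvPolynomial (Fin n) K →ₐ[K] MvPolynomial (Fin n) K := aeval (fun i => X i + C (a i)) with hτ
  set σ : MvPolynomial (Fin n) K →ₐ[K] MvPolynomial (Fin n) K := aeval (fun i => X i - C (a i)) with hσ
  have hστ : ∀ f, σ (τ f) = f := by
    intro f
    have hcomp : σ.comp τ = AlgHom.id K _ := by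
      refine MvPolynomial.algHom_ext fun i => ?_
      rw [AlgHom.comp_apply, hτ, aeval_X, map_add, hσ, aeval_X, aeval_C, algebraMap_eq, AlgHom.id_apply]
      ring
    exact DFunLike.congr_fun hcomp f
  -- `τ q` has no constant term: its evaluation at `0` is `q(a) = 0`
  have h0 : ∀ m ∈ (τ q).support, ∃ i ∈ (Set.univ : Set (Fin n)), (m : Fin n →₀ ℕ) i ≠ 0 := by
    intro m hm
    by_contra hcon
    push Not at hcon
    have hm0 : m = 0 := by
      ext i
      exact hcon i (Set.mem_univ i)
    subst hm0
    -- the constant coefficient of `τ q` is `q(a)`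
    have hcoeff : coeff 0 (τ q) = aeval a q := by
      have h1 : aeval (fun _ : Fin n => (0 : K)) (τ q) = aeval a q := by
        rw [hτ, ← AlgHom.comp_apply]
        congr 1
        refine MvPolynomial.algHom_ext fun i => ?_
        rw [AlgHom.comp_apply, aeval_X, map_add, aeval_X, aeval_C, zero_add, aeval_X]
        rfl
      rw [← h1]
      have h2 : aeval (fun _ : Fin n => (0 : K)) (τ q) = algebraMap K K (constantCoeff (τ q)) := aeval_zero (τ q)
      rw [h2, Algebra.algebraMap_self, RingHom.id_apply, constantCoeff_eq]
    rw [mem_support_iff, hcoeff, hq] at hm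
    exact hm rfl
  have hτq : τ q ∈ Ideal.span (MvPolynomial.X '' (Set.univ : Set (Fin n)) : Set (MvPolynomial (Fin n) K)) :=
    mem_ideal_span_X_image.mpr h0
  -- pull back along `σ`
  have himg : (Ideal.span (MvPolynomial.X '' (Set.univ : Set (Fin n)) : Set (MvPolynomial (Fin n) K))).map σ ≤
      Ideal.span (Set.range fun i : Fin n => X i - C (a i)) := by
    rw [Ideal.map_span]
    refine Ideal.span_le.mpr ?_
    rintro _ ⟨_, ⟨i, -, rfl⟩, rfl⟩
    have e : σ (X i) = X i - C (a i) := by rw [hσ, aeval_X]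
    rw [e]
    exact Ideal.subset_span ⟨i, rfl⟩
  have h := himg (Ideal.mem_map_of_mem σ hτq)
  rwa [hστ] at h

/-- Matrix bookkeeping for integer powers: `∏_j (∏_l u_l ^ A l j) ^ c j = ∏_l u_l ^ (Σ_j A l j * c j)` in a commutative group. [folklore] -/
theorem prod_prod_zpow_zpow {G : Type*} [CommGroup G] {n : ℕ} (u : Fin n → G) (A : Matrix (Fin n) (Fin n) ℤ) (c : Fin n → ℤ) :
    ∏ j, (∏ l, u l ^ A l j) ^ c j = ∏ l, u l ^ (∑ j, A l j * c j) := by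
  have h1 : ∀ j, (∏ l, u l ^ A l j) ^ c j = ∏ l, u l ^ (A l j * c j) := fun j => by
    rw [← Finset.prod_zpow]
    refine Finset.prod_congr rfl fun l _ => ?_
    rw [zpow_mul]
  simp_rw [h1]
  rw [Finset.prod_comm]
  refine Finset.prod_congr rfl fun l _ => ?_
  -- `∏_j u_l ^ e j = u_l ^ Σ_j e j` (as in `Literature…AbelianRadicalDescent.prod_zpow_eq_zpow_sum`, inlined to keep imports light)
  induction (Finset.univ : Finset (Fin n)) using Finset.induction_on with
  | empty => simp
  | insert i s hi ih => rw [Finset.prod_insert hi, Finset.sum_insert hi, ih, zpow_add]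

/-- `∏_l u_l ^ (𝟙 l i) = u i` for the identity integer matrix. [folklore] -/
theorem prod_zpow_one_apply {G : Type*} [CommGroup G] {n : ℕ} (u : Fin n → G) (i : Fin n) :
    ∏ l, u l ^ ((1 : Matrix (Fin n) (Fin n) ℤ) l i) = u i := by
  rw [Finset.prod_eq_single i]
  · rw [Matrix.one_apply_eq, zpow_one]
  · intro l _ hl
    rw [Matrix.one_apply_ne hl, zpow_zero]
  · intro h
    exact absurd (Finset.mem_univ i) h

/-! ## §1 The chart map sends the Frobenius power at `b` into the Frobenius power at `ã` -/

section Chart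

variable {K : Type} [Field K] {n : ℕ}

/-- Evaluation of the chart monomial: `(∏ᵢ Yᵢ ^ V i j)(a) = ∏ᵢ aᵢ ^ V i j`. [folklore] -/
theorem aeval_chartMonomial (V : Matrix (Fin n) (Fin n) ℕ) (a : Fin n → K) (j : Fin n) :
    aeval a (∏ i : Fin n, (X i : MvPolynomial (Fin n) K) ^ V i j) = ∏ i : Fin n, a i ^ V i j := by
  rw [map_prod]
  refine Finset.prod_congr rfl fun i _ => ?_
  rw [map_pow, aeval_X]

/-- **`θ` maps `((X_j - b_j)^p)` into `((Yᵢ - ãᵢ)^p)`** for the monomial chart `θ : X_j ↦ ∏ᵢ Yᵢ ^ V i j` and `b_j = ∏ᵢ ãᵢ ^ V i j`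
(`θ(X_j) - b_j` vanishes at `ã`, hence lies in `(Yᵢ - ãᵢ)`, and `p`-th powers of elements of `(Yᵢ - ãᵢ)` lie in `((Yᵢ - ãᵢ)^p)` in
characteristic `p`). [folklore] -/
theorem map_frobeniusSpan_le_of_monomialChart (p : ℕ) [Fact p.Prime] [CharP K p] (V : Matrix (Fin n) (Fin n) ℕ)
    (a : Fin n → K) :
    (Ideal.span (Set.range fun j : Fin n => (X j - C (∏ i : Fin n, a i ^ V i j)) ^ p)).map
      (aeval fun j : Fin n => ∏ i : Fin n, (X i : MvPolynomial (Fin n) K) ^ V i j) ≤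
      Ideal.span (Set.range fun i : Fin n => (X i - C (a i)) ^ p) := by
  rw [Ideal.map_span]
  refine Ideal.span_le.mpr ?_
  rintro _ ⟨_, ⟨j, rfl⟩, rfl⟩
  rw [SetLike.mem_coe, map_pow]
  refine pow_char_mem_span_pow p (fun i : Fin n => X i - C (a i)) (mem_span_X_sub_C_of_aeval_eq_zero a _ ?_)
  rw [map_sub, aeval_X, aeval_C, map_sub, aeval_chartMonomial, algebraMap_eq, aeval_C, Algebra.algebraMap_self,
    RingHom.id_apply, sub_self]

end Chart

/-! ## §2 Units in the Frobenius neighbourhood and the inverse chart -/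

section Neighbourhood

variable {K : Type} [Field K] {n : ℕ} (p : ℕ) [hp : Fact p.Prime]

omit hp in
/-- In `B = K[X]/((X_j - b_j)^p)`, the class of `X_j - b_j` is nilpotent. [folklore] -/
theorem isNilpotent_mk_X_sub_C (b : Fin n → K) (j : Fin n) :
    IsNilpotent (Ideal.Quotient.mk (Ideal.span (Set.range fun j : Fin n => (X j - C (b j)) ^ p))
      (X j - C (b j) : MvPolynomial (Fin n) K)) :=
  ⟨p, by rw [← map_pow, Ideal.Quotient.eq_zero_iff_mem]; exact Ideal.subset_span ⟨j, rfl⟩⟩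

omit hp in
/-- In `B = K[X]/((X_j - b_j)^p)` with `b_j ≠ 0`, the class `x̄_j` is a unit (`b_j` plus a nilpotent). [folklore] -/
theorem isUnit_mk_X (b : Fin n → K) (hb : ∀ j, b j ≠ 0) (j : Fin n) :
    IsUnit (Ideal.Quotient.mk (Ideal.span (Set.range fun j : Fin n => (X j - C (b j)) ^ p))
      (X j : MvPolynomial (Fin n) K)) := by
  have hu : IsUnit (Ideal.Quotient.mk (Ideal.span (Set.range fun j : Fin n => (X j - C (b j)) ^ p))
      (C (b j) : MvPolynomial (Fin n) K)) :=
    ((isUnit_iff_ne_zero.mpr (hb j)).map C).map _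
  have h := (isNilpotent_mk_X_sub_C p b j).isUnit_add_left_of_commute hu (Commute.all _ _)
  rwa [← map_add, add_sub_cancel] at h

/-- The units `x̄_j` of `B = K[X]/((X_j - b_j)^p)`, `b = (∏ᵢ ãᵢ ^ V i j)_j`, bundled; their images under evaluation at `b` are the `b_j`.
Together with the matrix `M = (V⁻¹)ᵀ` they define the inverse chart `ψ̄ : Yᵢ ↦ ∏_j x̄_j ^ M i j`.  This theorem packages the two
facts the transport needs: `ψ̄` kills `((Yᵢ - ãᵢ)^p)`, and `ψ̄ (θ X_j) = x̄_j`. [folklore] -/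
theorem exists_inverseChart [CharP K p] (V : Matrix (Fin n) (Fin n) ℕ) (hV : IsUnit (V.map (Nat.cast : ℕ → ℤ)).det)
    (a : Fin n → K) (ha : ∀ i, a i ≠ 0) :
    ∃ ψ : MvPolynomial (Fin n) K →ₐ[K]
        (MvPolynomial (Fin n) K ⧸ Ideal.span (Set.range fun j : Fin n => (X j - C (∏ i : Fin n, a i ^ V i j)) ^ p)),
      (∀ i : Fin n, ψ ((X i - C (a i)) ^ p) = 0) ∧
      ∀ j : Fin n, ψ (∏ i : Fin n, (X i : MvPolynomial (Fin n) K) ^ V i j) =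
        Ideal.Quotient.mk _ (X j) := by
  classical
  -- notation
  set b : Fin n → K := fun j => ∏ i : Fin n, a i ^ V i j with hb_def
  set J : Ideal (MvPolynomial (Fin n) K) := Ideal.span (Set.range fun j : Fin n => (X j - C (b j)) ^ p) with hJ
  have hb : ∀ j, b j ≠ 0 := fun j => Finset.prod_ne_zero_iff.mpr fun i _ => pow_ne_zero _ (ha i)
  -- the integer matrices
  set Vz : Matrix (Fin n) (Fin n) ℤ := V.map (Nat.cast : ℕ → ℤ) with hVz
  have hVinv1 : Vz⁻¹ * Vz = 1 := Matrix.nonsing_inv_mul Vz hV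
  have hVinv2 : Vz * Vz⁻¹ = 1 := Matrix.mul_nonsing_inv Vz hV
  -- the units `x̄_j`
  have hunit : ∀ j, IsUnit (Ideal.Quotient.mk J (X j : MvPolynomial (Fin n) K)) := isUnit_mk_X p b hb
  set U : Fin n → (MvPolynomial (Fin n) K ⧸ J)ˣ := fun j => (hunit j).unit with hU
  have hUval : ∀ j, ((U j : (MvPolynomial (Fin n) K ⧸ J)ˣ) : MvPolynomial (Fin n) K ⧸ J) = Ideal.Quotient.mk J (X j) :=
    fun j => (hunit j).unit_spec
  -- the inverse chart
  set W : Fin n → (MvPolynomial (Fin n) K ⧸ J)ˣ := fun i => ∏ j, U j ^ (Vz⁻¹) j i with hW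
  let ψ : MvPolynomial (Fin n) K →ₐ[K] (MvPolynomial (Fin n) K ⧸ J) := aeval fun i => (W i : MvPolynomial (Fin n) K ⧸ J)
  have hψX : ∀ i, ψ (X i) = W i := fun i => aeval_X _ i
  -- evaluation at `b` on `B`
  have hJle : ∀ q ∈ J, (aeval b : MvPolynomial (Fin n) K →ₐ[K] K).toRingHom q = 0 := by
    intro q hq
    have hle : J ≤ RingHom.ker (aeval b : MvPolynomial (Fin n) K →ₐ[K] K).toRingHom := by
      rw [hJ, Ideal.span_le]
      rintro _ ⟨j, rfl⟩
      rw [SetLike.mem_coe, RingHom.mem_ker]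
      change aeval b ((X j - C (b j)) ^ p) = 0
      rw [map_pow, map_sub, aeval_X, aeval_C, Algebra.algebraMap_self, RingHom.id_apply, sub_self,
        zero_pow hp.out.ne_zero]
    exact hle hq
  set ev : MvPolynomial (Fin n) K ⧸ J →+* K :=
    Ideal.Quotient.lift J (aeval b : MvPolynomial (Fin n) K →ₐ[K] K).toRingHom hJle with hev
  have hev_mk : ∀ q, ev (Ideal.Quotient.mk J q) = aeval b q := fun q => Ideal.Quotient.lift_mk J _ _
  -- the units `α i = a i` of `K` and `ev (U j) = b j = ∏_l α_l ^ V l j`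
  set α : Fin n → Kˣ := fun i => Units.mk0 (a i) (ha i) with hα
  have hevU : ∀ j, Units.map (ev : MvPolynomial (Fin n) K ⧸ J →* K) (U j) = ∏ l, α l ^ Vz l j := fun j => by
    ext
    rw [Units.coe_map, MonoidHom.coe_coe, hUval, hev_mk, aeval_X, Units.coe_prod]
    refine Finset.prod_congr rfl fun l _ => ?_
    rw [hVz, Matrix.map_apply, zpow_natCast, Units.val_pow_eq_pow_val, Units.val_mk0]
  -- `ev (W i) = a i`
  have hevW : ∀ i, ev (W i : MvPolynomial (Fin n) K ⧸ J) = a i := fun i => by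
    have h1 : Units.map (ev : MvPolynomial (Fin n) K ⧸ J →* K) (W i) = α i := by
      rw [hW]
      dsimp only
      rw [map_prod]
      simp_rw [map_zpow, hevU]
      rw [prod_prod_zpow_zpow α Vz (fun j => (Vz⁻¹) j i)]
      have hcol : ∀ l, (∑ j, Vz l j * (Vz⁻¹) j i) = (1 : Matrix (Fin n) (Fin n) ℤ) l i := fun l => by
        rw [← hVinv2, Matrix.mul_apply]
      simp_rw [hcol]
      exact prod_zpow_one_apply α i
    have h2 := congrArg (fun u : Kˣ => (u : K)) h1
    simpa only [Units.coe_map, MonoidHom.coe_coe, hα, Units.val_mk0] using h2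
  refine ⟨ψ, fun i => ?_, fun j => ?_⟩
  · -- `ψ ((Yᵢ - ãᵢ)^p) = (W i - a i)^p = 0`
    rw [map_pow, map_sub, hψX, aeval_C]
    obtain ⟨q, hq⟩ := Ideal.Quotient.mk_surjective
      ((W i : MvPolynomial (Fin n) K ⧸ J) - algebraMap K (MvPolynomial (Fin n) K ⧸ J) (a i))
    have hqb : aeval b q = 0 := by
      rw [← hev_mk, hq, map_sub, hevW]
      change a i - ev (Ideal.Quotient.mk J (C (a i))) = 0
      rw [hev_mk, aeval_C, Algebra.algebraMap_self, RingHom.id_apply, sub_self]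
    have hqJ : q ^ p ∈ J := by
      rw [hJ]
      exact pow_char_mem_span_pow p (fun j : Fin n => X j - C (b j)) (mem_span_X_sub_C_of_aeval_eq_zero b q hqb)
    rw [← hq, ← map_pow, Ideal.Quotient.eq_zero_iff_mem]
    exact hqJ
  · -- `ψ (θ X_j) = ∏ᵢ (W i)^(V i j) = U j = x̄_j`
    rw [map_prod]
    have h1 : ∀ i, ψ ((X i : MvPolynomial (Fin n) K) ^ V i j) = ((W i ^ Vz i j : (MvPolynomial (Fin n) K ⧸ J)ˣ) :
        MvPolynomial (Fin n) K ⧸ J) := fun i => by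
      rw [map_pow, hψX, hVz, Matrix.map_apply, zpow_natCast, Units.val_pow_eq_pow_val]
    simp_rw [h1]
    rw [← Units.coe_prod, hW]
    dsimp only
    rw [prod_prod_zpow_zpow U Vz⁻¹ (fun i => Vz i j)]
    have hcol : ∀ l, (∑ i, (Vz⁻¹) l i * Vz i j) = (1 : Matrix (Fin n) (Fin n) ℤ) l j := fun l => by
      rw [← hVinv1, Matrix.mul_apply]
    simp_rw [hcol]
    rw [prod_zpow_one_apply U j, hUval]

end Neighbourhood

/-! ## §3 The transport -/

section Transport

variable {K : Type} [Field K] {n : ℕ} (p : ℕ) [hp : Fact p.Prime] [CharP K p]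

/-- **Frobenius-neighbourhood transport along a unimodular monomial chart.**  Let `V` be an `n × n` exponent matrix over `ℕ` with
`det V = ±1`, `θ : X_j ↦ ∏ᵢ Yᵢ ^ V i j` the chart map, `ã` a point with all `ãᵢ ≠ 0` and `b_j = ∏ᵢ ãᵢ ^ V i j`.  Then for every `h` and
`r`: `θ(h)^r ∈ ((Yᵢ - ãᵢ)^p : i) ⟹ h^r ∈ ((X_j - b_j)^p : j)`.  (The inverse chart `ψ̄` of `exists_inverseChart` satisfies
`ψ̄ ∘ θ = (reduction mod ((X_j - b_j)^p))` and kills `((Yᵢ - ãᵢ)^p)`.) [folklore] -/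
theorem pow_mem_frobeniusSpan_of_monomialChart (V : Matrix (Fin n) (Fin n) ℕ) (hV : IsUnit (V.map (Nat.cast : ℕ → ℤ)).det)
    (a : Fin n → K) (ha : ∀ i, a i ≠ 0) (h : MvPolynomial (Fin n) K) (r : ℕ)
    (hmem : (aeval (fun j : Fin n => ∏ i : Fin n, (X i : MvPolynomial (Fin n) K) ^ V i j) h) ^ r ∈
      Ideal.span (Set.range fun i : Fin n => (X i - C (a i)) ^ p)) :
    h ^ r ∈ Ideal.span (Set.range fun j : Fin n => (X j - C (∏ i : Fin n, a i ^ V i j)) ^ p) := by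
  obtain ⟨ψ, hψ0, hψθ⟩ := exists_inverseChart p V hV a ha
  set θ : MvPolynomial (Fin n) K →ₐ[K] MvPolynomial (Fin n) K :=
    aeval (fun j : Fin n => ∏ i : Fin n, (X i : MvPolynomial (Fin n) K) ^ V i j) with hθ
  -- `ψ ∘ θ` is the reduction map
  have hcomp : ψ.comp θ = Ideal.Quotient.mkₐ K
      (Ideal.span (Set.range fun j : Fin n => (X j - C (∏ i : Fin n, a i ^ V i j)) ^ p)) := by
    refine MvPolynomial.algHom_ext fun j => ?_
    rw [AlgHom.comp_apply, hθ, aeval_X, hψθ j, Ideal.Quotient.mkₐ_eq_mk]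
  -- `ψ` kills the Frobenius power at `ã`
  have hker : Ideal.span (Set.range fun i : Fin n => (X i - C (a i)) ^ p) ≤ RingHom.ker ψ.toRingHom := by
    rw [Ideal.span_le]
    rintro _ ⟨i, rfl⟩
    rw [SetLike.mem_coe, RingHom.mem_ker]
    exact hψ0 i
  have h1 : ψ (θ (h ^ r)) = 0 := by
    have hmem' : θ (h ^ r) ∈ Ideal.span (Set.range fun i : Fin n => (X i - C (a i)) ^ p) := by
      rw [map_pow]; exact hmem
    have h2 := hker hmem'
    rwa [RingHom.mem_ker] at h2
  rw [← AlgHom.comp_apply, hcomp, Ideal.Quotient.mkₐ_eq_mk, Ideal.Quotient.eq_zero_iff_mem] at h1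
  exact h1

/-- **Fedder's test moves along the monomial chart** (contrapositive form, idea-2's `FedderAt p h b → FedderAt p (θ h) ã`): if
`h^(p-1) ∉ ((X_j - b_j)^p : j)` at `b = (∏ᵢ ãᵢ ^ V i j)_j`, then `θ(h)^(p-1) ∉ ((Yᵢ - ãᵢ)^p : i)`. [folklore] -/
theorem fedder_monomialChart_of_fedder (V : Matrix (Fin n) (Fin n) ℕ) (hV : IsUnit (V.map (Nat.cast : ℕ → ℤ)).det)
    (a : Fin n → K) (ha : ∀ i, a i ≠ 0) (h : MvPolynomial (Fin n) K)
    (hfed : h ^ (p - 1) ∉ Ideal.span (Set.range fun j : Fin n => (X j - C (∏ i : Fin n, a i ^ V i j)) ^ p)) :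
    (aeval (fun j : Fin n => ∏ i : Fin n, (X i : MvPolynomial (Fin n) K) ^ V i j) h) ^ (p - 1) ∉
      Ideal.span (Set.range fun i : Fin n => (X i - C (a i)) ^ p) :=
  fun hmem => hfed (pow_mem_frobeniusSpan_of_monomialChart p V hV a ha h (p - 1) hmem)

end Transport

end Summit.ResolutionOfSingularities.ResolutionOfSingularities.Theorems.FInjectiveMacaulayfication.MonomialChartFrobeniusTransport

end
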